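import Mathlib
import HarnessLib
import Summits.HubbardSuperconductivity.HubbardSuperconductivity.Theorems.KLProgrammeKLRegimeSplitTwoLegSizesMSFitSizes
import Summits.HubbardSuperconductivity.HubbardSuperconductivity.Theorems.KLProgrammeKLRegimeSplitTwoLegSizesMSFitDom
import Summits.HubbardSuperconductivity.HubbardSuperconductivity.Theorems.KLProgrammeKLRegimeSplitTwoLegSizesMSFitSlot0c1

/-!
# Route `KLProgramme`, crux K3 — ENGINE child (stmt-…-19918 → gen-6 engine child, `stub_twoLeg_step` / `stub_twoLeg_scale0`,
# clause (E3a-MS)): THE SLOT FITS AT THE GRADED LEVEL — closed-form slot size ≤ `Q.CE`-keyed budget, given ONE inequality on `Q.CE·G.S₁·Gfr_j`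

Cell `gate-hubbard-kl`, seat hubbard-kl-k3c3-p3 (g4) «implicit-function / monotonicity route for μ(n)»; MS-A34 (#42), plan g14 l.2058 / (R17)
(«the ONE inequality the engine's Q-package must satisfy»).  Graded variables: `x = 4^m` (slot), `y = 4^{n₀}` (scale, `n₀ ≥ 1`), `4y ≤ x`
(`m > n₀`), `0 < U ≤ 1`; slot grading `η ≤ 4Ḡ·U²/x²`, `λ ≤ 2x`, `e₀ ≤ 1923·Gfr₁·U²/(xy)` (Jackson order one at `d = 4^{n₀}`), frame sizes
`A₃ ≤ (4/3)Gfr₃U²y + λ₃Gfr₁U²y + (16/3)Gfr₃U²x`, `A₄ ≤ (16/15)Gfr₄U²y² + λ₄Gfr₁U²y² + (64/15)Gfr₄U²x²` (k3c3-p1's `msA3L/msA4L` with the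
low-part totals `Λ₃ ≤ λ₃Gfr₁U²4^{n₀}`, `Λ₄ ≤ λ₄Gfr₁U²16^{n₀}` of the mixed Jackson–Bernstein bound, MS-A34-ter),
increment-symbol profile `σ1 l ≤ μ_l·U²·(y/4)^{l−2}`, response profile `εm l ≤ ν_l·U²/y·pieceSize`, budget
`CE·(S1 + S1'U)·U²/y · (Gfr_j·uPow_j·x^{j−2})` (= `msBarQ … n₀ · pieceSize R U m j`).  For each order `j ≤ 4`: the `extSize` closed form of
`…MSFitSizesOsc` is ≤ the budget provided `REQ_j(X, μ, ν, Ḡ, Gfr) ≤ CE·S1·Gfr_j` (`ms_slot_fit_*`; `REQ_j` printed in the statement — the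
numerical content of MS-A34 §3 / STATUS 07:11Z, every term shape-checked by the generator).  Method: monotone substitution (`gcongr`), clearing
`x²y³` (`field_simp; ring`), per-monomial domination `Uᵃxᴾyᵠ ≤ w·U⁴xʲy²` (`fit_dom_hi/lo`, `U ≤ 1`, `y ≥ 4`, `x ≥ 4y`), summation.
THIS FILE: order 0, the fit `ms_slot_fit_zero`.  Pure real inequalities; everything PROVED; no definitions, no named facts. [folklore]
-/


noncomputable section

namespace Summit.HubbardSuperconductivity.HubbardSuperconductivity.Theorems.KLRegimeSplit

set_option linter.dupNamespace false -- summit = problem name (single-conjunct summit), D-0017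

open Real

set_option maxHeartbeats 800000 in
set_option maxRecDepth 8000 in
/-- **(E3a-MS) SLOT FIT, order 0** (graded level: `x = 4^m`, `y = 4^n₀`, `4y ≤ x`, `0 < U ≤ 1`): the closed-form majorant of the computed slot size is
below the `Q.CE`-keyed slot budget once `REQ_0 ≤ CE·S1·G0` (the R-dependent constant the engine's `Q` must carry). [folklore] -/
theorem ms_slot_fit_zero {X e₀ U x y G0 CE S1 S1' : ℝ} {εm σ1 μ ν : ℕ → ℝ}
    (hX : 0 ≤ X)
    (hU : 0 < U)
    (hU1 : U ≤ 1)
    (hy : 4 ≤ y)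
    (hyx : 4 * y ≤ x)
    (hG0 : 0 ≤ G0)
    (hCE : 0 ≤ CE)
    (hS1' : 0 ≤ S1')
    (hμ : ∀ i, 0 ≤ μ i)
    (hν : ∀ i, 0 ≤ ν i)
    (he₀0 : 0 ≤ e₀)
    (he₀ : e₀ ≤ 8 * G0 * U / x ^ 2)
    (hσ0 : ∀ i, 0 ≤ σ1 i)
    (hs1 : σ1 1 ≤ 4 * μ 1 * U ^ 2 / y)
    (hε0 : ∀ i, 0 ≤ εm i)
    (he0 : εm 0 ≤ ν 0 * U ^ 2 / y * (G0 * U / x ^ 2))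
    (hfit : (1 * (G0 * ν 0) + 224 * (G0 * μ 1) + 4 * (X * G0 * ν 0) + 896 * (X * G0 * μ 1)) ≤
      CE * S1 * G0) :
    extSize X (εm 0 + σ1 1 * (7 * e₀)) (2 * εm 0 +
        (14 * σ1 1 * e₀)) 0 ≤
      CE * (S1 + S1' * U) * U ^ 2 / y * (G0 * U / x ^ 2) := by
  rw [extSize_zero]
  have hx0 : 0 < x := by linarith
  have hy0 : 0 < y := by linarith
  have hxne : x ≠ 0 := hx0.ne'
  have hyne : y ≠ 0 := hy0.ne'
  have hD : 0 < x ^ 2 * y ^ 3 := by positivity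
  have := hμ 0
  have := hμ 1
  have := hμ 2
  have := hμ 3
  have := hμ 4
  have := hμ 5
  have := hν 0
  have := hν 1
  have := hν 2
  have := hν 3
  have := hν 4
  have := hσ0 0
  have := hσ0 1
  have := hσ0 2
  have := hσ0 3
  have := hσ0 4
  have := hσ0 5
  have := hε0 0
  have := hε0 1
  have := hε0 2
  have := hε0 3
  have := hε0 4
  have hre : εm 0 + σ1 1 * (7 * e₀) + 2 * X * (2 * εm 0 + (14 * σ1 1 * e₀)) =
      (εm 0) + (σ1 1 * (7 * e₀)) + (2 * X * (2 * εm 0)) + (2 * X * (14 * σ1 1 * e₀)) := by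
    ring
  have hF1 : (εm 0) + (σ1 1 * (7 * e₀)) + (2 * X * (2 * εm 0)) + (2 * X * (14 * σ1 1 * e₀)) ≤
      ((ν 0 * U ^ 2 / y * (G0 * U / x ^ 2))) + ((4 * μ 1 * U ^ 2 / y) * (7 * (8 * G0 * U / x ^ 2))) + (2 * X * (2 * (ν 0 * U ^ 2 / y * (G0 * U / x ^ 2)))) + (2 * X * (14 * (4 * μ 1 * U ^ 2 / y) * (8 * G0 * U / x ^ 2))) := by
    gcongr
  have key1 := ms_slot_key_zero_1 (X := X) (U := U) (G0 := G0) (μ := μ) (ν := ν) hxne hyne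
  have dom1 := ms_slot_dom_zero_1 (X := X) (U := U) (G0 := G0) (μ := μ) (ν := ν) hX hU hU1 hy hyx hG0 hμ hν
  have hm1 : ((εm 0) + (σ1 1 * (7 * e₀)) + (2 * X * (2 * εm 0)) + (2 * X * (14 * σ1 1 * e₀))) * (x ^ 2 * y ^ 3) ≤ (((ν 0 * U ^ 2 / y * (G0 * U / x ^ 2))) + ((4 * μ 1 * U ^ 2 / y) * (7 * (8 * G0 * U / x ^ 2))) + (2 * X * (2 * (ν 0 * U ^ 2 / y * (G0 * U / x ^ 2)))) + (2 * X * (14 * (4 * μ 1 * U ^ 2 / y) * (8 * G0 * U / x ^ 2)))) * (x ^ 2 * y ^ 3) := mul_le_mul_of_nonneg_right hF1 hD.le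
  have hreq : (1 * (G0 * ν 0) + 224 * (G0 * μ 1) + 4 * (X * G0 * ν 0) + 896 * (X * G0 * μ 1)) * (U ^ 3 * (x ^ 0 * y ^ 2)) =
      (1 * (G0 * ν 0) + 224 * (G0 * μ 1) + 4 * (X * G0 * ν 0) + 896 * (X * G0 * μ 1)) * (U ^ 3 * (x ^ 0 * y ^ 2)) := by
    ring
  have hdist : (εm 0 + σ1 1 * (7 * e₀) + 2 * X * (2 * εm 0 + (14 * σ1 1 * e₀))) * (x ^ 2 * y ^ 3) =
      ((εm 0) + (σ1 1 * (7 * e₀)) + (2 * X * (2 * εm 0)) + (2 * X * (14 * σ1 1 * e₀))) * (x ^ 2 * y ^ 3) := by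
    rw [hre]
    try ring
  have s3 : (1 * (G0 * ν 0) + 224 * (G0 * μ 1) + 4 * (X * G0 * ν 0) + 896 * (X * G0 * μ 1)) * (U ^ 3 * (x ^ 0 * y ^ 2)) ≤ CE * S1 * G0 * (U ^ 3 * (x ^ 0 * y ^ 2)) :=
    mul_le_mul_of_nonneg_right hfit (by positivity)
  have s4 : CE * (S1 + S1' * U) * U ^ 2 / y * (G0 * U / x ^ 2) * (x ^ 2 * y ^ 3) =
      CE * S1 * G0 * (U ^ 3 * (x ^ 0 * y ^ 2)) + CE * S1' * G0 * U * (U ^ 3 * (x ^ 0 * y ^ 2)) := by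
    field_simp
    try ring
  have s5 : 0 ≤ CE * S1' * G0 * U * (U ^ 3 * (x ^ 0 * y ^ 2)) := by positivity
  have hgoal : (εm 0 + σ1 1 * (7 * e₀) + 2 * X * (2 * εm 0 + (14 * σ1 1 * e₀))) * (x ^ 2 * y ^ 3) ≤ CE * (S1 + S1' * U) * U ^ 2 / y * (G0 * U / x ^ 2) * (x ^ 2 * y ^ 3) := by
    linarith only [hdist, hm1, key1, dom1, hreq, s3, s4, s5]
  exact le_of_mul_le_mul_right hgoal hD

end Summit.HubbardSuperconductivity.HubbardSuperconductivity.Theorems.KLRegimeSplit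

end
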